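import Summits.BirchSwinnertonDyer.BirchSwinnertonDyer.Theorems.InertBadSignedBranchesInertBadAtThreeQuarticThetaSymbol
import Literature.NumberTheory.QuadraticFields.GaussianQuarticSymbolValues
import Literature.NumberTheory.EllipticCurves.QuarticTwistThetaDictionary
import Literature.NumberTheory.EllipticCurves.NewformGaloisRepIntegralityProofs
import HarnessLib

/-!
# STUB-PLAN P1b (quartic theta dictionary), theta side II — the coefficient `Ψ`, its `3`-free part `Ψ'` (period `8|A|m`,
# integral values), the pointwise `3`-splitting, and `L(f ⊗ χ', s) = ¼ Θ-L_{3M'}(conj((·/3)₄)^k · Ψ')(s)`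

Summit `BirchSwinnertonDyer`, crux `InertBadAtThree` (stmt-BirchSwinnertonDyer-19225; K8 `InertBadSignedBranches` r4 / BED
`BiquadraticEisensteinDescent` r5), line of record `Cruxes/InertBadAtThree/Lines/rubin_e1_inert_three.lean` v5 (lead
`bsd-line-ibd-p1`), registered stub `stub_plainOddNeronIntegralThreeQuartic`; STUB-PLAN
`Cruxes/InertBadAtThree/STUB-PLAN-neronIntegralThreeQuartic-bsd-idea-18-g8.md` piece **P1b `stub_quarticThetaDictionary`**,
refined in `Cruxes/InertBadAtThree/QUARTIC_DICTIONARY_PLAN_bsd_idea_18_g9.lean` (v2) into Q1–Q8; this file (width seat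
bsd-wall-cm-bed-w2 g9, `--supports 19225`, helper) is the **theta side**: Q7 (`coeff_psi`), Q8a (`psi'_add_natCast_mul`),
Q8b (`isIntegral_psi'`), Q8c (`psi_threeSplit`), Q9 (`lSeries_eq_thetaLFunction`) and the composition
`quarticThetaDictionary_of_coeff` (f-free: `Σ χ'(n) aₙ(V) n^{-s}`, the shape of the P6 consumer
`…QuarticCleanAssembly.oddLValue_quartic_of_dictionary`) / `…_newform` (`L(f ⊗ χ', s)`, the g8 shape) = the interface P1b
from the COEFFICIENT IDENTITY
`a_n(V) = Σ_{x primary, N x = n} conj((D/x)₄)·x` (pieces Q3–Q6, width seat bsd-wall-cm-bed-w4) as the only hypothesis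
— discharged for the models `y² = x³ + Ax` by w4's landed `QuarticTwist.lFunction_eq_sum_primaryNormEq`, which gives the
hypothesis `hdictAll` of the closer of record `…QuarticStubOfModel.plainOddNeronIntegralThreeQuartic_of_dictionary` (p631807) as
the theorem `quarticThetaDictionary_hdictAll` (§5); the value `(−3/y)₄ = (y/3)₄` at primary `y` (Q2) is w4's landed
`quarticSymbolInt_neg_three_of_isPrimary`.

THE OBJECTS (written out, no definitions): for `φ : ℤ[i] → ℤ[i]` (the symbol `x ↦ (A/x)₄ = quarticSymbolInt A x`) and a
Dirichlet character `χ'` modulo `m`, `Ψ_{φ,χ'}(x) = χ'(N x) · conj(φ(x̃)) · u(x)` (`x̃ = u(x)·x` the primary associate,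
`u(x) = 0` for `1 + i ∣ x`; the template is `CongruentNumberCurveHeckeSeries.heckePsi n x = (n/N x)·u(x)`, the case `D = n²`),
and its `3`-free part `Ψ'_{φ,k,χ'}(x) = (u(x)/3)₄^k · Ψ_{φ,χ'}(x)`, `(·/3)₄ = GaussianQuarticSymbol.quarticCharThree`.  For
`D = (−3)^k A`, `3 ∤ A`: `Ψ_{(D/·)₄,χ'} = conj((·/3)₄)^k · Ψ'_{(A/·)₄,k,χ'}` pointwise, `Ψ'` has period `M' = 8|A|m ∌ 3`, and
`c_Ψ(n) = Σ_{N x = n} Ψ(x) x = 4 χ'(n) Σ_{x primary, N x = n} conj(φ x)·x`, whence `L(f ⊗ χ', s) = ¼ Θ-L_{3M'}(Ψ)(s)` by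
`GaussianTheta.thetaLFunction_eq_LSeries` (Ireland–Rosen, Ch. 18 §6, Theorem 7: `L(E_D, s) = L(s, χ)`,
`χ((x)) = conj((D/x̃)₄) x̃`, a Hecke character modulo `8D`).
HONEST FRAMING: bookkeeping identities for theta coefficients on `ℤ[i]`; nothing here proves the stub, the crux or BSD.
No definitions, no named facts, no `sorry`; axioms standard.
-/

set_option linter.dupNamespace false
set_option autoImplicit false

noncomputable section

open scoped ComplexConjugate
open Complex Zsqrtd
open Literature.NumberTheory.QuadraticFields Literature.NumberTheory.QuadraticFields.GaussianPrimary
open Literature.NumberTheory.QuadraticFields.GaussianQuarticSymbol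
open Literature.NumberTheory.EllipticCurves Literature.NumberTheory.EllipticCurves.GaussianPrimary
open Literature.NumberTheory.EllipticCurves.ModularForms
open Literature.NumberTheory.LFunctions Literature.NumberTheory.LFunctions.GaussianTheta

namespace Summit.BirchSwinnertonDyer.BirchSwinnertonDyer.Theorems.InertBadSignedBranchesInertBadAtThreeQuarticTheta

/-! ## §1 Regrouping by primary associates and the `L`-series coefficients of `θ_Ψ` (Q7) -/

/-- **Weighted `sum_normEq_primary`**: `Σ_{N x = m} g(x̃) = 4 Σ_{y primary, N y = m} g(y)` for any weight `g` with `g 0 = 0` —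
every primary `y` of norm `m` is `x̃` for exactly its four associates, and `x̃ = 0` on `1 + i ∣ x`. [folklore] -/
theorem sum_normEq_comp_primary_eq_mul {R : Type*} [CommRing R] (m : ℕ) (g : GaussianInt → R) (hg : g 0 = 0) :
    ∑ x ∈ normEq m, g (primary x) = 4 * ∑ y ∈ primaryNormEq m, g y := by
  classical
  have hmaps : ∀ x ∈ normEq m, primary x ∈ insert (0 : GaussianInt) (primaryNormEq m) := by
    intro x hx
    rw [mem_normEq] at hx
    rw [Finset.mem_insert, mem_primaryNormEq]
    by_cases hodd : (x.re + x.im) % 2 = 1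
    · exact Or.inr ⟨by rw [norm_primary hodd, hx], isPrimary_primary hodd⟩
    · exact Or.inl (primary_eq_zero_of_even (by omega))
  have h0P : (0 : GaussianInt) ∉ primaryNormEq m := by
    rw [mem_primaryNormEq, not_and]; exact fun _ h ↦ h.ne_zero rfl
  rw [← Finset.sum_fiberwise_of_maps_to hmaps, Finset.sum_insert h0P]
  have h0 : ∑ x ∈ (normEq m).filter (fun x ↦ primary x = 0), g (primary x) = 0 :=
    Finset.sum_eq_zero fun x hx ↦ by rw [(Finset.mem_filter.mp hx).2, hg]
  rw [h0, zero_add, Finset.mul_sum]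
  refine Finset.sum_congr rfl fun y hy ↦ ?_
  have hyp := (mem_primaryNormEq.mp hy).2
  rw [Finset.sum_congr rfl (fun x hx ↦ by rw [(Finset.mem_filter.mp hx).2]), Finset.sum_const,
    filter_primary_eq_image hy, Finset.card_image_of_injective _ (mul_left_injective₀ hyp.ne_zero), card_units4,
    nsmul_eq_mul]
  norm_num

/-- `Ψ_{φ,χ'}(x) · x = χ'(N x) · conj(φ(x̃)) · x̃` (`u(x) x = x̃`). [folklore] -/
theorem psi_mul_self (φ : GaussianInt → GaussianInt) {m : ℕ} (χ' : DirichletCharacter ℂ m) (x : GaussianInt) :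
    χ' ((x.norm : ℤ) : ZMod m) * ((star (φ (primary x)) * primaryUnit x : GaussianInt) : ℂ) * (x : ℂ) =
      χ' ((x.norm : ℤ) : ZMod m) * ((star (φ (primary x)) * primary x : GaussianInt) : ℂ) := by
  rw [primary_eq_primaryUnit_mul x, mul_assoc (χ' _), ← map_mul GaussianInt.toComplex, mul_assoc,
    ← primary_eq_primaryUnit_mul]

/-- **Q7 — the `L`-series coefficients of `θ_Ψ` are `c_Ψ(n) = 4 χ'(n) · Σ_{x primary, N x = n} conj(φ x) · x`**
(port of `coeff_heckePsi`; Ireland–Rosen Thm 18.7: `Σ_{N A = n} χ(A)` with `χ((x)) = conj((D/x̃)₄) x̃`). [folklore] -/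
theorem coeff_psi (φ : GaussianInt → GaussianInt) {m : ℕ} (χ' : DirichletCharacter ℂ m) (n : ℕ) :
    coeff (fun x ↦ χ' ((x.norm : ℤ) : ZMod m) * ((star (φ (primary x)) * primaryUnit x : GaussianInt) : ℂ)) n =
      4 * χ' n * ((∑ x ∈ primaryNormEq n, star (φ x) * x : GaussianInt) : ℂ) := by
  rw [coeff]
  have : ∀ x ∈ normEq n,
      χ' ((x.norm : ℤ) : ZMod m) * ((star (φ (primary x)) * primaryUnit x : GaussianInt) : ℂ) * (x : ℂ) =
        χ' n * (((fun y ↦ star (φ y) * y) (primary x) : GaussianInt) : ℂ) := by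
    intro x hx
    rw [psi_mul_self, mem_normEq.mp hx, Int.cast_natCast]
  rw [Finset.sum_congr rfl this, ← Finset.mul_sum, ← map_sum GaussianInt.toComplex,
    sum_normEq_comp_primary_eq_mul n (fun y ↦ star (φ y) * y) (by simp), map_mul, map_ofNat]
  ring

/-! ## §2 The `3`-free part `Ψ'`: periodicity (Q8a) and integrality (Q8b) -/

/-- Norms of `x + M' y` and `x` agree in `ZMod m` for `m ∣ M'`. [folklore] -/
theorem intCast_norm_add_natCast_mul {m M' : ℕ} (hmM : m ∣ M') (x y : GaussianInt) :
    (((x + (M' : GaussianInt) * y).norm : ℤ) : ZMod m) = ((x.norm : ℤ) : ZMod m) := by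
  rw [ZMod.intCast_eq_intCast_iff]
  exact (Int.ModEq.of_dvd (Int.natCast_dvd_natCast.mpr hmM) (norm_add_natCast_mul_emod M' x y))

/-- `(x + M' y)~ = x̃ + M'·(u(x) y)` for `4 ∣ M'` (the unit part only depends on `x mod 4`). [folklore] -/
theorem primary_add_natCast_mul {M' : ℕ} (h4 : 4 ∣ M') (x y : GaussianInt) :
    primary (x + (M' : GaussianInt) * y) = primary x + (M' : GaussianInt) * (primaryUnit x * y) := by
  rw [primary_eq_primaryUnit_mul, primaryUnit_add_natCast_mul h4, primary_eq_primaryUnit_mul x]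
  ring

/-- **Q8a — `Ψ'_{φ,k,χ'}` is periodic modulo every `M'` with `4 ∣ M'`, `P ∣ M'`, `m ∣ M'`, when `φ` has period `P` on primary
arguments** (port of `heckePsi_add_mul`: `u(x + M'y) = u(x)`, `(x + M'y)~ = x̃ + M'(u(x)y)`, `N(x + M'y) ≡ N x (mod m)`;
for `1 + i ∣ x` both sides vanish with `u(x) = 0`). [folklore] -/
theorem psi'_add_natCast_mul {φ : GaussianInt → GaussianInt} {P : ℕ}
    (hper : ∀ x y : GaussianInt, IsPrimary x → φ (x + (P : GaussianInt) * y) = φ x)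
    (k : ℕ) {m : ℕ} (χ' : DirichletCharacter ℂ m) {M' : ℕ} (h4 : 4 ∣ M') (hP : P ∣ M') (hmM : m ∣ M')
    (x y : GaussianInt) :
    ((quarticCharThree (primaryUnit (x + (M' : GaussianInt) * y)) : GaussianInt) : ℂ) ^ k *
        (χ' (((x + (M' : GaussianInt) * y).norm : ℤ) : ZMod m) *
          ((star (φ (primary (x + (M' : GaussianInt) * y))) * primaryUnit (x + (M' : GaussianInt) * y) :
            GaussianInt) : ℂ)) =
      ((quarticCharThree (primaryUnit x) : GaussianInt) : ℂ) ^ k *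
        (χ' ((x.norm : ℤ) : ZMod m) * ((star (φ (primary x)) * primaryUnit x : GaussianInt) : ℂ)) := by
  rw [primaryUnit_add_natCast_mul h4, intCast_norm_add_natCast_mul hmM, primary_add_natCast_mul h4]
  by_cases hodd : (x.re + x.im) % 2 = 1
  · obtain ⟨c, hc⟩ := hP
    have : primary x + (M' : GaussianInt) * (primaryUnit x * y) =
        primary x + (P : GaussianInt) * ((c : GaussianInt) * (primaryUnit x * y)) := by
      rw [hc]; push_cast; ring
    rw [this, hper _ _ (isPrimary_primary hodd)]
  · rw [primaryUnit_eq_zero_of_even (by omega)]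
    simp

/-- **Q8b — the values of `Ψ'_{φ,k,χ'}` are algebraic integers** (`(u/3)₄`, `conj(φ x̃)·u(x)` are Gaussian integers and the
values of a Dirichlet character are integral, `ModularForms.isIntegral_dirichletCharacter_apply`). [folklore] -/
theorem isIntegral_psi' (φ : GaussianInt → GaussianInt) (k : ℕ) {m : ℕ} [NeZero m] (χ' : DirichletCharacter ℂ m)
    (x : GaussianInt) :
    IsIntegral ℤ (((quarticCharThree (primaryUnit x) : GaussianInt) : ℂ) ^ k *
      (χ' ((x.norm : ℤ) : ZMod m) * ((star (φ (primary x)) * primaryUnit x : GaussianInt) : ℂ))) :=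
  ((QuarticTwist.isIntegral_toComplex _).pow k).mul
    ((isIntegral_dirichletCharacter_apply χ' _).mul (QuarticTwist.isIntegral_toComplex _))

/-! ## §3 The pointwise `3`-splitting `Ψ_{(·/3)₄^k φ} = conj((·/3)₄)^k · Ψ'_{φ,k}` (Q8c) -/

/-- **Q8c (abstract form) — the `3`-part splits off pointwise**: if `φ' = (·/3)₄^k · φ` on primary arguments then
`Ψ_{φ',χ'}(x) = conj((x/3)₄)^k · Ψ'_{φ,k,χ'}(x)` (`(x̃/3)₄ = (u/3)₄ (x/3)₄`, `(u/3)₄ = ±1` real; both sides vanish for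
`1 + i ∣ x`). [folklore] -/
theorem psi_threeSplit {φ φ' : GaussianInt → GaussianInt} {k : ℕ}
    (hsplit : ∀ y : GaussianInt, IsPrimary y → φ' y = quarticCharThree y ^ k * φ y)
    {m : ℕ} (χ' : DirichletCharacter ℂ m) (x : GaussianInt) :
    χ' ((x.norm : ℤ) : ZMod m) * ((star (φ' (primary x)) * primaryUnit x : GaussianInt) : ℂ) =
      (starRingEnd ℂ ((quarticCharThree x : GaussianInt) : ℂ)) ^ k *
        (((quarticCharThree (primaryUnit x) : GaussianInt) : ℂ) ^ k *
          (χ' ((x.norm : ℤ) : ZMod m) * ((star (φ (primary x)) * primaryUnit x : GaussianInt) : ℂ))) := by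
  by_cases hodd : (x.re + x.im) % 2 = 1
  · rw [hsplit _ (isPrimary_primary hodd), primary_eq_primaryUnit_mul x, quarticCharThree_mul, star_mul',
      star_pow, star_mul', star_quarticCharThree_primaryUnit]
    simp only [map_mul, map_pow, GaussianInt.toComplex_star]
    ring
  · rw [primaryUnit_eq_zero_of_even (by omega)]
    simp

/-! ## §4 Q9 and the composition: P1b from the coefficient identity -/

/-- `D = (−3)^{v₃(D)} · A` with `3 ∤ A`, `A ≠ 0`. [folklore] -/
theorem exists_eq_neg_three_pow_mul {D : ℤ} (hD : D ≠ 0) :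
    ∃ A : ℤ, A ≠ 0 ∧ ¬ (3 : ℤ) ∣ A ∧ D = (-3) ^ (padicValInt 3 D) * A := by
  haveI : Fact (Nat.Prime 3) := ⟨Nat.prime_three⟩
  obtain ⟨B, hB⟩ := padicValInt_dvd (p := 3) D
  have hB' : D = 3 ^ padicValInt 3 D * B := by simpa using hB
  have h3B : ¬ (3 : ℤ) ∣ B := by
    rintro ⟨C, hC⟩
    have h : ((3 : ℕ) : ℤ) ^ (padicValInt 3 D + 1) ∣ D := by
      refine ⟨C, ?_⟩
      calc D = 3 ^ padicValInt 3 D * B := hB'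
        _ = ((3 : ℕ) : ℤ) ^ (padicValInt 3 D + 1) * C := by rw [hC]; push_cast; ring
    rcases (padicValInt_dvd_iff (p := 3) _ D).mp h with h0 | h0
    · exact hD h0
    · omega
  refine ⟨(-1) ^ padicValInt 3 D * B, ?_, ?_, ?_⟩
  · intro h
    rcases mul_eq_zero.mp h with h1 | h1
    · exact pow_ne_zero _ (by norm_num) h1
    · exact hD (by rw [hB', h1, mul_zero])
  · intro h
    exact h3B ((isUnit_one.neg.pow _).dvd_mul_left.mp h)
  · rw [← mul_assoc, ← mul_pow]
    norm_num
    exact hB'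

/-- **Q9 — a periodic theta coefficient with `c_Ψ(n) = 4 χ'(n) a(n)` gives `Σ χ'(n) a(n) n^{-s} = ¼ Θ-L_M(Ψ)(s)` for
`re s > 3/2`** (`GaussianTheta.thetaLFunction_eq_LSeries`, termwise). [folklore] -/
theorem lSeries_eq_thetaLFunction (a : ℕ → ℂ) {m : ℕ} (χ' : DirichletCharacter ℂ m) (M : ℕ) [NeZero M]
    (Ψ : GaussianInt → ℂ) (hΨ : ∀ x y : GaussianInt, Ψ (x + (M : GaussianInt) * y) = Ψ x)
    (hcoeff : ∀ n : ℕ, n ≠ 0 → coeff Ψ n = 4 * χ' n * a n) {s : ℂ} (hs : 3 / 2 < s.re) :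
    LSeries (fun n ↦ χ' n * a n) s = (1 / 4 : ℂ) * thetaLFunction M Ψ s := by
  rw [thetaLFunction_eq_LSeries M Ψ hΨ hs, LSeries, LSeries, ← tsum_mul_left]
  congr 1
  funext n
  simp only [LSeries.term]
  split_ifs with hn
  · rw [mul_zero]
  · rw [hcoeff n hn]
    ring

/-- **P1b from the coefficient identity (the theta side of the quartic dictionary).**  Let `V/ℚ` have Dirichlet
coefficients `a_n(V) = Σ_{x primary, N x = n} conj((D/x)₄)·x` (`n ≥ 1`; Ireland–Rosen Thm 18.7 for `y² = x³ − Dx`, `D ≠ 0`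
fourth-power-free — pieces Q3–Q6 of the plan, hypothesis `hcoef`), let `f` be its newform and `χ'` a Dirichlet character
modulo `m` with `3 ∤ m` (`(−3/y)₄ = (y/3)₄` at primary `y`, Q2, is the tree's `quarticSymbolInt_neg_three_of_isPrimary`).  Then with
`k = v₃(D)`,
`D = (−3)^k A`, `M' = 8|A|m` (`3 ∤ M'`, `4 ∣ M'`, `m ∣ M'`) and `Ψ' = Ψ'_{(A/·)₄,k,χ'}` (periodic modulo `M'`, integral
values): `L(f ⊗ χ', s) = ¼ Θ-L_{3M'}(conj((·/3)₄)^k · Ψ')(s)` for `re s > 3/2` — the g8 interface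
`stub_quarticThetaDictionary` with `χ' = χ⁻¹` and the tree's `ℤ[i]`-valued `(·/3)₄` read in `ℂ`
(`toComplex_quarticCharThree` is the P6 table `hq`). [folklore] -/
theorem quarticThetaDictionary_of_coeff (V : WeierstrassCurve ℚ) {D : ℤ} (hD : D ≠ 0)
    (hcoef : ∀ n : ℕ, n ≠ 0 →
      ((V.LFunction n : ℤ) : GaussianInt) = ∑ x ∈ primaryNormEq n, star (quarticSymbolInt D x) * x)
    {m : ℕ} [NeZero m] (hm3 : ¬ 3 ∣ m) (χ' : DirichletCharacter ℂ m) :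
    ∃ (M' : ℕ) (_ : NeZero M') (_ : NeZero (3 * M')) (Ψ' : GaussianInt → ℂ),
      ¬ 3 ∣ M' ∧ Nat.Coprime 3 M' ∧ 4 ∣ M' ∧ m ∣ M' ∧
      (∀ x y : GaussianInt, Ψ' (x + (M' : GaussianInt) * y) = Ψ' x) ∧
      (∀ x : GaussianInt, IsIntegral ℤ (Ψ' x)) ∧
      (∀ s : ℂ, 3 / 2 < s.re →
        LSeries (fun n : ℕ ↦ χ' (n : ZMod m) * (V.LFunction n : ℂ)) s =
          (1 / 4 : ℂ) * thetaLFunction (3 * M')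
            (fun x ↦ (starRingEnd ℂ ((quarticCharThree x : GaussianInt) : ℂ)) ^ (padicValInt 3 D) * Ψ' x) s) := by
  -- `D = (-3)^k A`, `3 ∤ A`, `A ≠ 0`, and the `3`-splitting of the symbol on primary arguments
  obtain ⟨A, hA0, hA3, hDA⟩ := exists_eq_neg_three_pow_mul hD
  set k : ℕ := padicValInt 3 D with hk
  have hsplitφ : ∀ y : GaussianInt, IsPrimary y →
      quarticSymbolInt D y = quarticCharThree y ^ k * quarticSymbolInt A y :=
    fun y hy ↦ quarticSymbolInt_threeSplit (fun z hz ↦ quarticSymbolInt_neg_three_of_isPrimary hz) hDA hy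
  -- the modulus `M' = 8|A| m`
  have hm0 : m ≠ 0 := NeZero.ne m
  have hA3' : ¬ 3 ∣ A.natAbs := fun h ↦ hA3 (Int.natCast_dvd.mpr h)
  set M' : ℕ := 8 * A.natAbs * m with hM'
  have hM'0 : M' ≠ 0 := mul_ne_zero (mul_ne_zero (by norm_num) (Int.natAbs_ne_zero.mpr hA0)) hm0
  haveI hM'3 : NeZero (3 * M') := ⟨mul_ne_zero (by norm_num) hM'0⟩
  have h3M' : ¬ 3 ∣ M' := by
    intro h
    rcases (Nat.Prime.dvd_mul Nat.prime_three).mp h with h | h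
    · rcases (Nat.Prime.dvd_mul Nat.prime_three).mp h with h | h
      · omega
      · exact hA3' h
    · exact hm3 h
  have h4M' : 4 ∣ M' := ⟨2 * A.natAbs * m, by rw [hM']; ring⟩
  have hmM' : m ∣ M' := Dvd.intro_left _ rfl
  have h8M' : 8 * A.natAbs ∣ M' := Dvd.intro _ rfl
  -- periodicity of `(A/·)₄` modulo `8|A|` on primary arguments (Q1d)
  have hperφ : ∀ x y : GaussianInt, IsPrimary x →
      quarticSymbolInt A (x + ((8 * A.natAbs : ℕ) : GaussianInt) * y) = quarticSymbolInt A x := by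
    intro x y hx
    have h8 : ((8 * A.natAbs : ℕ) : GaussianInt) = ((8 * |A| : ℤ) : GaussianInt) := by
      simp [Nat.cast_natAbs]
    rw [h8]
    exact quarticSymbolInt_add_mul_of_isPrimary hA0 hx y
  -- `Ψ`, `Ψ'` and the pointwise splitting `Ψ = conj((·/3)₄)^k Ψ'`
  set Ψ : GaussianInt → ℂ := fun x ↦
    χ' ((x.norm : ℤ) : ZMod m) * ((star (quarticSymbolInt D (primary x)) * primaryUnit x : GaussianInt) : ℂ) with hΨ
  set Ψ' : GaussianInt → ℂ := fun x ↦ ((quarticCharThree (primaryUnit x) : GaussianInt) : ℂ) ^ k *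
    (χ' ((x.norm : ℤ) : ZMod m) * ((star (quarticSymbolInt A (primary x)) * primaryUnit x : GaussianInt) : ℂ))
    with hΨ'
  have hsplit : ∀ x : GaussianInt,
      Ψ x = (starRingEnd ℂ ((quarticCharThree x : GaussianInt) : ℂ)) ^ k * Ψ' x :=
    fun x ↦ psi_threeSplit hsplitφ χ' x
  have hperΨ' : ∀ x y : GaussianInt, Ψ' (x + (M' : GaussianInt) * y) = Ψ' x :=
    fun x y ↦ psi'_add_natCast_mul hperφ k χ' h4M' h8M' hmM' x y
  -- periodicity of `Ψ` modulo `3 M'`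
  have hperΨ : ∀ x y : GaussianInt, Ψ (x + ((3 * M' : ℕ) : GaussianInt) * y) = Ψ x := by
    intro x y
    rw [hsplit, hsplit x]
    have h1 : quarticCharThree (x + ((3 * M' : ℕ) : GaussianInt) * y) = quarticCharThree x := by
      have : x + ((3 * M' : ℕ) : GaussianInt) * y = x + 3 * ((M' : GaussianInt) * y) := by push_cast; ring
      rw [this, quarticCharThree_add_three_mul]
    have h2 : Ψ' (x + ((3 * M' : ℕ) : GaussianInt) * y) = Ψ' x := by
      have : x + ((3 * M' : ℕ) : GaussianInt) * y = x + (M' : GaussianInt) * (3 * y) := by push_cast; ring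
      rw [this, hperΨ']
    rw [h1, h2]
  -- the coefficients `c_Ψ(n) = 4 χ'(n) aₙ(V)` (Q7 + the coefficient identity)
  have hcoeff : ∀ n : ℕ, n ≠ 0 → coeff Ψ n = 4 * χ' n * (V.LFunction n : ℂ) := by
    intro n hn
    rw [hΨ, coeff_psi, ← hcoef n hn, map_intCast]
  have h3M'' : Nat.Coprime 3 M' := (Nat.Prime.coprime_iff_not_dvd Nat.prime_three).mpr h3M'
  refine ⟨M', ⟨hM'0⟩, hM'3, Ψ', h3M', h3M'', h4M', hmM', hperΨ', fun x ↦ isIntegral_psi' _ k χ' x, fun s hs ↦ ?_⟩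
  rw [lSeries_eq_thetaLFunction (fun n ↦ (V.LFunction n : ℂ)) χ' (3 * M') Ψ hperΨ hcoeff hs]
  congr 2
  funext x
  exact hsplit x

/-- **P1b in the language of the newform** (the g8 interface `stub_quarticThetaDictionary`, up to currency): under the same
hypotheses, for the newform `f` of `V` (`IsNewformOf V f`: `aₙ(f) = aₙ(V)`), `L(f ⊗ χ', s) = ¼ Θ-L_{3M'}(conj((·/3)₄)^k · Ψ')(s)`
for `re s > 2`. [folklore] -/
theorem quarticThetaDictionary_of_coeff_newform (V : WeierstrassCurve ℚ) {D : ℤ} (hD : D ≠ 0)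
    (hcoef : ∀ n : ℕ, n ≠ 0 →
      ((V.LFunction n : ℤ) : GaussianInt) = ∑ x ∈ primaryNormEq n, star (quarticSymbolInt D x) * x)
    {N : ℕ} [NeZero N] (f : CuspForm (CongruenceSubgroup.Gamma0 N) 2) (hf : IsNewformOf V f)
    {m : ℕ} [NeZero m] (hm3 : ¬ 3 ∣ m) (χ' : DirichletCharacter ℂ m) :
    ∃ (M' : ℕ) (_ : NeZero (3 * M')) (Ψ' : GaussianInt → ℂ),
      ¬ 3 ∣ M' ∧ 4 ∣ M' ∧ m ∣ M' ∧
      (∀ x y : GaussianInt, Ψ' (x + (M' : GaussianInt) * y) = Ψ' x) ∧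
      (∀ x : GaussianInt, IsIntegral ℤ (Ψ' x)) ∧
      (∀ s : ℂ, 2 < s.re →
        twistedLSeries f χ' s =
          (1 / 4 : ℂ) * thetaLFunction (3 * M')
            (fun x ↦ (starRingEnd ℂ ((quarticCharThree x : GaussianInt) : ℂ)) ^ (padicValInt 3 D) * Ψ' x) s) := by
  obtain ⟨M', _, hM'3, Ψ', h3M', -, h4M', hmM', hper, hint, hL⟩ := quarticThetaDictionary_of_coeff V hD hcoef hm3 χ'
  refine ⟨M', hM'3, Ψ', h3M', h4M', hmM', hper, hint, fun s hs ↦ ?_⟩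
  rw [← hL s (by linarith), twistedLSeries]
  congr 1
  funext n
  rw [hf.2 n]

/-- **P1b at the model `y² = x³ + A x`, in the consumer's shape** (hypothesis `hdict` of the P6 assembly
`…QuarticCleanAssembly.oddLValue_quartic_of_dictionary`: `χ⁻¹`, `re s > 2`, exponent `v₃(A)`, `Nat.Coprime 3 M'`): from the
coefficient identity `a_n(E) = Σ_{x primary, N x = n} conj((−A/x)₄)·x` of `E : y² = x³ + Ax = x³ − (−A)x`, `A ≠ 0`. [folklore] -/
theorem quarticThetaDictionary_model_of_coeff (A : ℤ) (hA : A ≠ 0)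
    (hcoef : ∀ n : ℕ, n ≠ 0 →
      ((((⟨0, 0, 0, (A : ℚ), 0⟩ : WeierstrassCurve ℚ).LFunction n : ℤ) : GaussianInt) =
        ∑ x ∈ primaryNormEq n, star (quarticSymbolInt (-A) x) * x))
    {m : ℕ} [NeZero m] (hm3 : ¬ 3 ∣ m) (χ : DirichletCharacter ℂ m) :
    ∃ (M' : ℕ) (_ : NeZero M') (_ : NeZero (3 * M')) (Ψ' : GaussianInt → ℂ),
      Nat.Coprime 3 M' ∧ 4 ∣ M' ∧ m ∣ M' ∧
      (∀ x y : GaussianInt, Ψ' (x + (M' : GaussianInt) * y) = Ψ' x) ∧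
      (∀ x : GaussianInt, IsIntegral ℤ (Ψ' x)) ∧
      (∀ s : ℂ, 2 < s.re →
        LSeries (fun n : ℕ ↦ χ⁻¹ (n : ZMod m) * ((⟨0, 0, 0, (A : ℚ), 0⟩ : WeierstrassCurve ℚ).LFunction n : ℂ)) s =
          (1 / 4 : ℂ) * thetaLFunction (3 * M')
            (fun x ↦ (starRingEnd ℂ ((quarticCharThree x : GaussianInt) : ℂ)) ^ (padicValInt 3 A) * Ψ' x) s) := by
  obtain ⟨M', hM', hM'3, Ψ', -, h3M', h4M', hmM', hper, hint, hL⟩ :=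
    quarticThetaDictionary_of_coeff (⟨0, 0, 0, (A : ℚ), 0⟩ : WeierstrassCurve ℚ) (neg_ne_zero.mpr hA) hcoef hm3 χ⁻¹
  have hv : padicValInt 3 (-A) = padicValInt 3 A := by rw [padicValInt, padicValInt, Int.natAbs_neg]
  refine ⟨M', hM', hM'3, Ψ', h3M', h4M', hmM', hper, hint, fun s hs ↦ ?_⟩
  rw [← hv]
  exact hL s (by linarith)

/-! ## §5 The hypothesis `hdictAll` of the closer of record, discharged -/

section Dictionary

variable {q : GaussianInt → ℂ}
  (hq : ∀ x : GaussianInt, q x =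
    if (3 : ℤ) ∣ x.re ∧ (3 : ℤ) ∣ x.im then 0
    else if (3 : ℤ) ∣ x.im then 1
    else if (3 : ℤ) ∣ x.re then -1
    else if (3 : ℤ) ∣ x.re - x.im then -I
    else I)

include hq

/-- ★ **STUB-PLAN P1b — the theta dictionary for the quartic models, in the shape `hdictAll` of the closer of record
`…QuarticStubOfModel.plainOddNeronIntegralThreeQuartic_of_dictionary`** (the weight `q = (·/3)₄` entering through the table `hq`):
for every `A ≠ 0`, fourth-power-free, every `ℓ ≡ 11 (mod 12)` and every Dirichlet character `χ` modulo `ℓ` there are `M'` prime to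
`3` and an `M'`-periodic `Ψ` with algebraic-integer values such that `Σ χ̄(n) a_n(y² = x³ + Ax) n^{-s} =
¼ Θ-L_{3M'}(conj(q)^{v₃(A)} · Ψ)(s)` for `re s > 2` (the antecedents `3 ∣ A`, `ℓ` prime, `ℓ ∤ A`, `χ` odd, `χ(3) ≠ 1` are not used).
Assembled from `quarticThetaDictionary_model_of_coeff` and w4's coefficient identity `QuarticTwist.lFunction_eq_sum_primaryNormEq`
(Ireland–Rosen Thm 18.7) at `D = −A`. [folklore] -/
theorem quarticThetaDictionary_hdictAll :
    ∀ (A : ℤ), A ≠ 0 → (3 : ℤ) ∣ A → (∀ p : ℕ, p.Prime → ¬ ((p : ℤ) ^ 4 ∣ A)) →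
      ∀ (ℓ : ℕ) [NeZero ℓ], ℓ.Prime → ℓ % 12 = 11 → ¬ (ℓ : ℤ) ∣ A →
      ∀ χ : DirichletCharacter ℂ ℓ, χ.Odd → χ (3 : ZMod ℓ) ≠ 1 →
      ∃ (M' : ℕ) (_ : NeZero M') (_ : NeZero (3 * M')) (Ψ : GaussianInt → ℂ),
        Nat.Coprime 3 M' ∧ (∀ x y : GaussianInt, Ψ (x + M' * y) = Ψ x) ∧ (∀ x : GaussianInt, IsIntegral ℤ (Ψ x)) ∧
        ∀ s : ℂ, 2 < s.re →
          LSeries (fun n : ℕ ↦ χ⁻¹ (n : ZMod ℓ) * ((⟨0, 0, 0, (A : ℚ), 0⟩ : WeierstrassCurve ℚ).LFunction n : ℂ)) s =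
            (1 / 4 : ℂ) * thetaLFunction (3 * M') (fun x ↦ (conj (q x)) ^ (padicValInt 3 A) * Ψ x) s := by
  intro A hA0 _ h4 ℓ _ _ h12 _ χ _ _
  -- `3 ∤ ℓ` from `ℓ ≡ 11 (mod 12)`
  have hℓ3 : ¬ 3 ∣ ℓ := by omega
  -- the coefficient identity for `y² = x³ + Ax = x³ − (−A)x` (w4, Ireland–Rosen Thm 18.7)
  have h4' : ∀ p : ℕ, p.Prime → ¬ (p : ℤ) ^ 4 ∣ -A := fun p hp h ↦ h4 p hp (dvd_neg.mp h)
  have hE : (⟨0, 0, 0, -((-A : ℤ) : ℚ), 0⟩ : WeierstrassCurve ℚ) = ⟨0, 0, 0, (A : ℚ), 0⟩ := by simp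
  have hcoef : ∀ n : ℕ, n ≠ 0 →
      ((((⟨0, 0, 0, (A : ℚ), 0⟩ : WeierstrassCurve ℚ).LFunction n : ℤ) : GaussianInt) =
        ∑ x ∈ primaryNormEq n, star (quarticSymbolInt (-A) x) * x) := by
    intro n hn
    rw [← hE]
    exact QuarticTwist.lFunction_eq_sum_primaryNormEq (neg_ne_zero.mpr hA0) h4' hn
  -- the table `q = (·/3)₄`
  have hq' : ∀ x : GaussianInt, q x = ((quarticCharThree x : GaussianInt) : ℂ) := fun x ↦ by
    rw [hq, toComplex_quarticCharThree]
  obtain ⟨M', hM', hM'3, Ψ', h3M', -, -, hper, hint, hL⟩ := quarticThetaDictionary_model_of_coeff A hA0 hcoef hℓ3 χ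
  refine ⟨M', hM', hM'3, Ψ', h3M', hper, hint, fun s hs ↦ ?_⟩
  rw [hL s hs]
  congr 2
  funext x
  rw [hq']

end Dictionary

end Summit.BirchSwinnertonDyer.BirchSwinnertonDyer.Theorems.InertBadSignedBranchesInertBadAtThreeQuarticTheta

end
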